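import Mathlib
import Summits.ResolutionOfSingularities.ResolutionOfSingularities.Theorems.WeightedInvariantLocalWeightedDropMonicDescentGraphCurveTools

/-!
# `WeightedInvariant.LocalWeightedDrop`, sub-stub N4″: a well-preparing re-centring keeps `(ζ, ε)` when the lowest-row vertex is odd (tool for T-5′)

Crux item stmt-ResolutionOfSingularities-8899 `LocalWeightedDrop` (route `ResolutionOfSingularities/WeightedInvariant`), door
`WeightedConstruction` stmt-ResolutionOfSingularities-0571.  [OURS · L1 W4.3, chain w43, lead prover; tool for the TAIL ARGUMENT of piece T-5′
(`stub_monicDescentNoChain`) of `N4PRIME-PLAN.md` (CJS LNM 2270 proof of Thm 13.7: `ε` constant and `ζ` dropping along the limit label).  Mirror image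
of `…MonicDescentPrepInvariance` (p489391) with the roles of the two coordinates exchanged.]

* `epsL_recentre_eq`, `zetaL_recentre_eq` — if the lowest-row-leftmost point `(2ζ, 2ε)` of `newtonSet A₀ A₁` is ODD and `ψ` is a well-preparing
  re-centring (`IsPrepRecentring`), then the re-centred label has the same `2ε` and `2ζ`.
-/

set_option linter.dupNamespace false -- mandated namespace of this single-conjunct summit

noncomputable section

namespace Summit.ResolutionOfSingularities.ResolutionOfSingularities.Theorems

namespace MonicDescent

open MvPowerSeries

variable {k : Type} [Field k] [CharP k 2]

/-- If the lowest-row-leftmost point of `N(A₀, A₁)` is ODD and `ψ` is a well-preparing re-centring, then `2ε` is unchanged. -/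
theorem epsL_recentre_eq {A₀ A₁ ψ : MvPowerSeries (Fin 2) k} (hprep : IsPrepRecentring A₀ A₁ ψ) {P : Fin 2 →₀ ℕ}
    (hP : P ∈ newtonSet A₀ A₁) (h1 : P 1 = epsL (newtonSet A₀ A₁)) (h0 : P 0 = zetaL (newtonSet A₀ A₁)) (hodd : IsOdd A₀ A₁ P) :
    epsL (newtonSet (recentre ψ A₀ A₁).1 (recentre ψ A₀ A₁).2) = epsL (newtonSet A₀ A₁) := by
  obtain ⟨hψ0, -, hWP, hpers⟩ := hprep
  set B₀ := (recentre ψ A₀ A₁).1 with hB₀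
  have hB₁ : (recentre ψ A₀ A₁).2 = A₁ := recentre_snd_eq ψ A₀ A₁
  rw [hB₁] at hWP hpers ⊢
  obtain ⟨hvert', hcoef⟩ := hpers P (isVertex_rowMin hP h1 h0) hodd
  have hP' : P ∈ newtonSet B₀ A₁ := hvert'.1
  apply le_antisymm
  · rw [← h1]; exact epsL_le hP'
  · by_contra hlt
    push Not at hlt
    have hne' : (newtonSet B₀ A₁).Nonempty := ⟨P, hP'⟩
    obtain ⟨Q, hQ, hQ1, hQ0⟩ := exists_eq_zetaL hne'
    have hQv : IsVertex (newtonSet B₀ A₁) Q := isVertex_rowMin hQ hQ1 hQ0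
    have hQodd : IsOdd B₀ A₁ Q := hWP Q hQv
    have hQlt : Q 1 < epsL (newtonSet A₀ A₁) := by rw [hQ1]; exact hlt
    rcases hQodd with ⟨e, rfl, he⟩ | ⟨hQc, hQi⟩
    · have := epsL_le (N := newtonSet A₀ A₁) (P := 2 • e) (Or.inr ⟨e, rfl, he⟩)
      omega
    · by_cases hA1pt : ∃ e : Fin 2 →₀ ℕ, Q = 2 • e ∧ coeff e A₁ ≠ 0
      · obtain ⟨e, rfl, he⟩ := hA1pt
        have := epsL_le (N := newtonSet A₀ A₁) (P := 2 • e) (Or.inr ⟨e, rfl, he⟩)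
        omega
      push Not at hA1pt
      set L : ℕ := Q 0 + 1 with hL
      set w : Fin 2 → ℕ := fun i => if i = 0 then 1 else L with hw
      have hweight : ∀ d : Fin 2 →₀ ℕ, Finsupp.weight w d = d 0 + L * d 1 := by
        intro d
        rw [Finsupp.weight_apply, Finsupp.sum_fintype _ _ (by simp)]
        simp [Fin.sum_univ_two, hw]
        ring
      obtain ⟨d, hd, hdle⟩ := exists_low_exponent_of_recentre w B₀ A₁ ψ Q hQc hQi
        (fun d hd => by
          rw [hweight, hweight]
          have hd1 := epsL_le (N := newtonSet B₀ A₁) (Or.inl hd)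
          rcases Nat.lt_or_ge (Q 1) (d 1) with hlt' | hge
          · nlinarith
          · have hd1eq : d 1 = epsL (newtonSet B₀ A₁) := by omega
            have := zetaL_le (N := newtonSet B₀ A₁) (Or.inl hd) hd1eq
            rw [hQ0, hQ1]; rw [hd1eq]; omega)
        (fun a ha => by
          rw [hweight, hweight]
          have hmem : (2 • a) ∈ newtonSet B₀ A₁ := Or.inr ⟨a, rfl, ha⟩
          have ha1 := epsL_le hmem
          simp only [Finsupp.smul_apply, smul_eq_mul] at ha1
          rcases Nat.lt_or_ge (Q 1) (2 * a 1) with hlt' | hge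
          · nlinarith
          · have ha1eq : (2 • a) 1 = epsL (newtonSet B₀ A₁) := by
              simp only [Finsupp.smul_apply, smul_eq_mul]; omega
            have ha0 := zetaL_le hmem ha1eq
            simp only [Finsupp.smul_apply, smul_eq_mul] at ha0
            have hne2 : 2 • a ≠ Q := fun h => ha (hA1pt a h.symm)
            have hne0 : 2 * a 0 ≠ Q 0 := by
              intro h
              apply hne2
              exact Literature.RingTheory.TwoVariableSeries.finsupp_fin2_ext
                (by simp only [Finsupp.smul_apply, smul_eq_mul]; omega) (by simp only [Finsupp.smul_apply, smul_eq_mul]; omega)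
            have h2a1 : 2 * a 1 = Q 1 := by omega
            have hQ0le : Q 0 ≤ 2 * a 0 := by rw [hQ0]; exact ha0
            have hexp : 2 * (a 0 + L * a 1) = 2 * a 0 + L * (2 * a 1) := by ring
            rw [hexp, h2a1]
            omega)
      have hback : B₀ + A₁ * ψ + ψ ^ 2 = A₀ := by
        rw [hB₀]
        change A₀ + A₁ * ψ + ψ ^ 2 + A₁ * ψ + ψ ^ 2 = A₀
        have h2 : (2 : MvPowerSeries (Fin 2) k) = 0 := two_eq_zero
        linear_combination (A₁ * ψ + ψ ^ 2) * h2
      rw [hback] at hd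
      have hdmem : d ∈ newtonSet A₀ A₁ := Or.inl hd
      have hd1 := epsL_le hdmem
      rw [hweight, hweight] at hdle
      have : d 1 ≤ Q 1 := by
        by_contra hgt
        push Not at hgt
        nlinarith
      omega

/-- Under the same hypotheses `2ζ` is unchanged: the odd lowest-row vertex `P = (2ζ, 2ε)` persists as a vertex of the new Newton set, so no new
point of the row `2ε` lies left of it. -/
theorem zetaL_recentre_eq {A₀ A₁ ψ : MvPowerSeries (Fin 2) k} (hprep : IsPrepRecentring A₀ A₁ ψ) {P : Fin 2 →₀ ℕ}
    (hP : P ∈ newtonSet A₀ A₁) (h1 : P 1 = epsL (newtonSet A₀ A₁)) (h0 : P 0 = zetaL (newtonSet A₀ A₁)) (hodd : IsOdd A₀ A₁ P) :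
    zetaL (newtonSet (recentre ψ A₀ A₁).1 (recentre ψ A₀ A₁).2) = zetaL (newtonSet A₀ A₁) := by
  have hε := epsL_recentre_eq hprep hP h1 h0 hodd
  obtain ⟨hψ0, -, hWP, hpers⟩ := hprep
  obtain ⟨hvert', hcoef⟩ := hpers P (isVertex_rowMin hP h1 h0) hodd
  have hP' := hvert'.1
  apply le_antisymm
  · rw [← h0]
    exact zetaL_le hP' (by rw [hε]; exact h1)
  · by_contra hlt
    push Not at hlt
    obtain ⟨Q, hQ, hQ1, hQ0⟩ := exists_eq_zetaL (N := newtonSet (recentre ψ A₀ A₁).1 (recentre ψ A₀ A₁).2) ⟨P, hP'⟩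
    obtain ⟨-, w, hw, hmin⟩ := hvert'
    have hne : Q ≠ P := by
      intro h
      rw [h, h0] at hQ0
      omega
    have hlt' := hmin Q hQ hne
    have hwt : ∀ R : Fin 2 →₀ ℕ, Finsupp.weight w R = w 0 * R 0 + w 1 * R 1 := by
      intro R
      rw [Finsupp.weight_apply, Finsupp.sum_fintype _ _ (by simp)]
      simp [Fin.sum_univ_two]
      ring
    rw [hwt, hwt] at hlt'
    have hQ1' : Q 1 = P 1 := by rw [hQ1, hε, h1]
    rw [hQ1'] at hlt'
    have hQ0lt : Q 0 < P 0 := by rw [hQ0, h0]; exact hlt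
    have := hw 0
    nlinarith

end MonicDescent

end Summit.ResolutionOfSingularities.ResolutionOfSingularities.Theorems

end
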